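import Literature.AlgebraicGeometry.HodgeTheory.AtiyahClass
import Literature.AlgebraicGeometry.Modules.CechClassOfLocallySplit
import Literature.AlgebraicGeometry.Modules.CechEndCochain
import HarnessLib

/-!
# The Atiyah class as a Čech cocycle: `At(E) = [{dT_{ab}}]` in the frames of `E`

For a commutative ring `S`, an `S`-scheme `X : Over (Spec S)` and an `𝒪_X`-module `E` with a framing
`𝔣 = (U_a, e_a)` (frames `e_a : 𝒪^{I_a} ≅ E|_{U_a}`, `Modules/CechEndCochain.lean`), each frame
SPLITS the Atiyah (jet) sequence `0 → E ⊗ Ω¹ → P¹(E) → E → 0` (`HodgeTheory/AtiyahClass.lean`) over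
`U_a`: the `𝒪`-linear section

  `s_a : E|_{U_a} → P¹(E)|_{U_a}`,  `b_{a,i} ↦ (b_{a,i}, 0)`  (`frameJetSection`),

i.e. the "trivial connection" of the frame (Atiyah 1957, §4: in a local trivialisation `D(E) ≅
E ⊕ E ⊗ Ω¹`); on a section `x = Σ_i λ_i b_{a,i}` it takes the value `(x, Σ_i b_{a,i} ⊗ dλ_i)`
(`appLE_frameJetSection`). By `Modules/CechClassOfLocallySplit.lean` the Atiyah class — the
`Ext¹`-class of the jet sequence — is therefore the ČECH CLASS of the difference cocycle of these
splittings: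

  `atiyahClass E = Cech.classOf a (atiyahCocycle 𝔣)`  (`atiyahClass_eq_classOf`),

and the cocycle is computed in the frames: on the basis of `e_b`,

  `atiyahCocycle 𝔣 (a,b) (b_{b,l}) = Σ_i b_{a,i} ⊗ d(T_{ab})_{il}`  (`appLE_atiyahCocycle_basisSection`),

the classical cocycle `{dT_{ab} · T_{ab}⁻¹}` / `{g_{ab}⁻¹ dg_{ab}}` representing `b(E)` (Atiyah 1957,
Prop. 12 for line bundles; Buchweitz–Flenner 2003 §3). This is the `Ext`-free description of `At`
needed to compute `σ₁ = Tr(At ∘ −)` on Čech obstruction cocycles by block matrices. Everything is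
proved; no named facts.

## References

* M. F. Atiyah, *Complex analytic connections in fibre bundles*, Trans. AMS 85 (1957), §4,
  Prop. 12. [Atiyah1957]
* R.-O. Buchweitz, H. Flenner, Compositio Math. 137 (2003), §3 (Atiyah class). [BuchweitzFlenner2003]
* R. Hartshorne, *Algebraic Geometry*, GTM 52 (1977), III.4. [Hartshorne1977]
-/

noncomputable section

universe u

open CategoryTheory CategoryTheory.Abelian AlgebraicGeometry Opposite TopologicalSpace Limits

namespace Literature.AlgebraicGeometry.HodgeTheory

open Literature.AlgebraicGeometry.Modules Literature.AlgebraicGeometry.Motives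
  Literature.Algebra.Homology

variable {S : Type u} [CommRing S] {X : Over (Spec (CommRingCat.of S))} (E : X.left.Modules)
  {W V : X.left.Opens} {I : Type u}

/-! ### Values of a morphism out of a framed module on the basis sections -/

/-- The value of `φ : E|_W → M|_W` on the `i`-th basis section of a frame `e` of `E|_W` is the `i`-th
section of the family classifying `e ≫ φ : 𝒪^I → M|_W`. [folklore] -/
lemma appLE_basisSection_eq {M : X.left.Modules} (e : SheafOfModules.free I ≅ E.over W)
    (φ : E.over W ⟶ M.over W) (i : I) :
    appLE φ (𝟙 W) (basisSection e i) =
      Scheme.Modules.overSectionsEquiv M W ((M.over W).freeHomEquiv (e.hom ≫ φ) i) := by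
  rw [basisSection, SheafOfModules.freeHomEquiv_comp_apply, overSectionsEquiv_sectionsMap']

/-! ### The frame splitting of the jet sequence -/

section FrameSplitting

variable (e : SheafOfModules.free I ≅ E.over W)

/-- **The section of the jet sequence defined by a frame** ("trivial connection of the frame"):
the `𝒪`-linear map `E|_W → P¹(E)|_W` with `b_i ↦ (b_i, 0)`. [cite: Atiyah1957, §4] -/
def frameJetSection : E.over W ⟶ (jetModule E).over W :=
  e.inv ≫ ((jetModule E).over W).freeHomEquiv.symm fun i =>
    (Scheme.Modules.overSectionsEquiv (jetModule E) W).symm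
      (JetSections.mk (basisSection e i) 0 : JetSections E W)

/-- On basis sections: `s_e(b_i) = (b_i, 0)`. [cite: Atiyah1957, §4] -/
theorem appLE_frameJetSection_basisSection (i : I) :
    appLE (frameJetSection E e) (𝟙 W) (basisSection e i) =
      (JetSections.mk (basisSection e i) 0 : JetSections E W) := by
  rw [appLE_basisSection_eq, frameJetSection, Iso.hom_inv_id_assoc, Equiv.apply_symm_apply,
    Equiv.apply_symm_apply]

/-- Restricted basis sections: `s_e(b_i|_V) = (b_i|_V, 0)`. [folklore] -/
theorem appLE_frameJetSection_map_basisSection (k : V ⟶ W) (i : I) :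
    appLE (frameJetSection E e) k (E.presheaf.map k.op (basisSection e i)) =
      (JetSections.mk (E.presheaf.map k.op (basisSection e i)) 0 : JetSections E V) := by
  have h := appLE_map (frameJetSection E e) (𝟙 W) k (basisSection e i)
  rw [Category.comp_id] at h
  rw [h, appLE_frameJetSection_basisSection]
  rfl

variable [Fintype I]

omit [Fintype I] in
/-- First components of a finite sum of jet sections. [folklore] -/
lemma JetSections.fst_sum {ι' : Type*} (t : Finset ι') (q : ι' → JetSections E V) :
    JetSections.fst (∑ i ∈ t, q i) = ∑ i ∈ t, JetSections.fst (q i) :=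
  map_sum (⟨⟨JetSections.fst, JetSections.fst_zero⟩, JetSections.fst_add⟩ : JetSections E V →+ Γ(E, V)) q t

omit [Fintype I] in
/-- Second components of a finite sum of jet sections. [folklore] -/
lemma JetSections.snd_sum {ι' : Type*} (t : Finset ι') (q : ι' → JetSections E V) :
    JetSections.snd (∑ i ∈ t, q i) = ∑ i ∈ t, JetSections.snd (q i) :=
  map_sum (⟨⟨JetSections.snd, JetSections.snd_zero⟩, JetSections.snd_add⟩ :
    JetSections E V →+ ((dual E).over V ⟶ (cotangentSheaf X).over V)) q t

/-- **Values of the frame section**: `s_e(x) = (x, Σ_i b_i ⊗ dλ_i(x))` for `x = Σ_i λ_i(x) b_i`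
over `V ≤ W` (the twisted module structure `λ · (b, 0) = (λ b, b ⊗ dλ)`).
[cite: Atiyah1957, §4 (p. 193)] -/
theorem appLE_frameJetSection (k : V ⟶ W) (x : Γ(E, V)) :
    appLE (frameJetSection E e) k x =
      (JetSections.mk x (∑ i, deltaHom E V (coord e k x i) (E.presheaf.map k.op (basisSection e i))) :
        JetSections E V) := by
  rw [appLE_eq_sum_coord e (frameJetSection E e) k x]
  simp_rw [appLE_frameJetSection_map_basisSection]
  refine JetSections.ext ?_ ?_
  · -- first components: `Σ λ_i b_i| = x`
    change JetSections.fst (∑ i, coord e k x i • (JetSections.mk (E.presheaf.map k.op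
      (basisSection e i)) 0 : JetSections E V)) = x
    rw [JetSections.fst_sum]
    simp_rw [JetSections.fst_smul, JetSections.fst_mk]
    exact (eq_sum_coord_smul e k x).symm
  · change JetSections.snd (∑ i, coord e k x i • (JetSections.mk (E.presheaf.map k.op
      (basisSection e i)) 0 : JetSections E V)) = _
    rw [JetSections.snd_sum]
    simp_rw [JetSections.snd_smul, JetSections.snd_mk, JetSections.fst_mk, smul_zero, zero_add]

/-- `s_e` is a section of `P¹(E) → E` over `W`. [cite: Atiyah1957, §4] -/
theorem frameJetSection_comp_g :
    frameJetSection E e ≫ (SheafOfModules.overFunctor _ W).map (jetπ E) = 𝟙 (E.over W) := by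
  refine hom_ext_of_appLE fun V k x => ?_
  rw [appLE_comp, appLE_over_map, appLE_id, appLE_frameJetSection]
  rfl

/-- **The splitting of the jet sequence over `W` defined by the frame `e`.** [cite: Atiyah1957, §4] -/
def frameJetSplitting : ((jetShortComplex E).map (Scheme.Modules.overFunctor W)).Splitting :=
  Cech.localSplittingOfSection (jetShortComplex_shortExact E) W (frameJetSection E e)
    (by exact frameJetSection_comp_g E e)

/-- The section of the frame splitting is `s_e`. [folklore] -/
@[simp] lemma frameJetSplitting_s : (frameJetSplitting E e).s = frameJetSection E e := rfl

/-- **The retraction of the frame splitting** (retyped on `P¹(E)|_W → (E ⊗ Ω¹)|_W`). [folklore] -/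
def frameJetRetraction : (jetModule E).over W ⟶ (twistCotangent E).over W := (frameJetSplitting E e).r

/-- `r_e ≫ ι = 𝟙 - π ≫ s_e` (Mathlib `Splitting.r_f`). [folklore] -/
lemma frameJetRetraction_comp_ι :
    frameJetRetraction E e ≫ (SheafOfModules.overFunctor _ W).map (jetι E) =
      𝟙 ((jetModule E).over W) - (SheafOfModules.overFunctor _ W).map (jetπ E) ≫ frameJetSection E e :=
  (frameJetSplitting E e).r_f

/-- Values of a difference of local homomorphisms. [folklore] -/
lemma appLE_sub' {M N : X.left.Modules} {U' W' : X.left.Opens} (φ ψ : M.over U' ⟶ N.over U')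
    (k : W' ⟶ U') (s : Γ(M, W')) : appLE (φ - ψ) k s = appLE φ k s - appLE ψ k s :=
  map_sub (appLEHom k s) φ ψ

/-- **Values of the retraction of the frame splitting**: `r_e(p) = p.snd - (s_e p.fst).snd`, i.e.
`r_e(x, φ) = φ - Σ_i b_i ⊗ dλ_i(x)` (from `r ≫ ι = 𝟙 - π ≫ s` and `ι = (0, ·)`).
[folklore] -/
theorem appLE_frameJetRetraction (k : V ⟶ W) (p : Γ(jetModule E, V)) :
    appLE (frameJetRetraction E e) k p =
      JetSections.snd (p : JetSections E V) -
        ∑ i, deltaHom E V (coord e k (JetSections.fst (p : JetSections E V)) i)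
          (E.presheaf.map k.op (basisSection e i)) := by
  have h' := congrArg (fun φ => appLE φ k p) (frameJetRetraction_comp_ι E e)
  simp only [appLE_comp, appLE_over_map, appLE_sub', appLE_id, jetι_app_apply, jetπ_app_apply,
    appLE_frameJetSection] at h'
  have := congrArg JetSections.snd h'
  rw [JetSections.snd_mk] at this
  rw [this]
  rfl

end FrameSplitting

/-! ### The Atiyah cocycle of a framing -/

section Cocycle

variable {E} {ι : Type u} (𝔣 : Framing E ι)

/-- The local splittings of the jet sequence given by a framing. [folklore] -/
def frameJetSplittings : Cech.LocalSplittings 𝔣.U (jetShortComplex E) := fun a =>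
  frameJetSplitting E (𝔣.e a)

/-- **The Atiyah cocycle of a framing**: the difference cocycle `s_a ≫ r_b` of the frame splittings of
the jet sequence, a Čech `1`-cocycle of local homomorphisms `E|_{U_a ∩ U_b} → (E ⊗ Ω¹)|_{U_a ∩ U_b}`.
[cite: Atiyah1957, §4 (b(E) ∈ H¹(X, Hom(E, E ⊗ T*)))] -/
def atiyahCocycle : Cech.LocalFamily 𝔣.U 1 E (twistCotangent E) :=
  Cech.splittingDifference (frameJetSplittings 𝔣)

/-- The Atiyah cocycle is a cocycle. [cite: Atiyah1957, §4] -/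
theorem dFamily_atiyahCocycle : Cech.dFamily (atiyahCocycle 𝔣) = 0 :=
  Cech.dFamily_splittingDifference _

/-- Unfolding the Atiyah cocycle: `At_{ab}(x) = r_b(s_a(x))` with the frame section `s_a` and the
frame retraction `r_b`. [folklore] -/
theorem appLE_atiyahCocycle_eq (β : Fin 2 → ι) {V : X.left.Opens} (k : V ⟶ face 𝔣.U β) (x : Γ(E, V)) :
    appLE (atiyahCocycle 𝔣 β) k x =
      appLE (frameJetRetraction E (𝔣.e (β 1))) (k ≫ homOfLE (face_le 𝔣.U β 1))
        (appLE (frameJetSection E (𝔣.e (β 0))) (k ≫ homOfLE (face_le 𝔣.U β 0)) x) := rfl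

/-- **Values of the Atiyah cocycle**: for `x ∈ Γ(E, V)`, `V ≤ U_a ∩ U_b`,
`At_{ab}(x) = Σ_i b_{a,i} ⊗ dλ^a_i(x) - Σ_j b_{b,j} ⊗ dλ^b_j(x)` (difference of the trivial
connections of the two frames). [cite: Atiyah1957, §4] -/
theorem appLE_atiyahCocycle (β : Fin 2 → ι) {V : X.left.Opens} (k : V ⟶ face 𝔣.U β) (x : Γ(E, V)) :
    appLE (atiyahCocycle 𝔣 β) k x =
      ∑ i, deltaHom E V (coord (𝔣.e (β 0)) (k ≫ homOfLE (face_le 𝔣.U β 0)) x i)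
          (E.presheaf.map (k ≫ homOfLE (face_le 𝔣.U β 0)).op (basisSection (𝔣.e (β 0)) i)) -
        ∑ j, deltaHom E V (coord (𝔣.e (β 1)) (k ≫ homOfLE (face_le 𝔣.U β 1)) x j)
          (E.presheaf.map (k ≫ homOfLE (face_le 𝔣.U β 1)).op (basisSection (𝔣.e (β 1)) j)) := by
  rw [appLE_atiyahCocycle_eq, appLE_frameJetRetraction, appLE_frameJetSection, JetSections.snd_mk,
    JetSections.fst_mk]

/-- **The Atiyah cocycle on basis sections: the matrix `dT_{ab}` read in the frame `e_a`.** For the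
`l`-th basis section of `e_b` (restricted to `V ≤ U_a ∩ U_b`),
`At_{ab}(b_{b,l}) = Σ_i b_{a,i} ⊗ d(T_{ab})_{il}`, `T_{ab} = T(e_a, e_b)` the transition matrix.
[cite: Atiyah1957, Prop. 12] [cite: BuchweitzFlenner2003, §3] -/
theorem appLE_atiyahCocycle_basisSection (β : Fin 2 → ι) {V : X.left.Opens} (k : V ⟶ face 𝔣.U β)
    (l : 𝔣.I (β 1)) :
    appLE (atiyahCocycle 𝔣 β) k
        (E.presheaf.map (k ≫ homOfLE (face_le 𝔣.U β 1)).op (basisSection (𝔣.e (β 1)) l)) =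
      ∑ i, deltaHom E V
        (transition (𝔣.e (β 0)) (𝔣.e (β 1)) (k ≫ homOfLE (face_le 𝔣.U β 0))
          (k ≫ homOfLE (face_le 𝔣.U β 1)) i l)
        (E.presheaf.map (k ≫ homOfLE (face_le 𝔣.U β 0)).op (basisSection (𝔣.e (β 0)) i)) := by
  rw [appLE_atiyahCocycle]
  have hb : ∑ j, deltaHom E V (coord (𝔣.e (β 1)) (k ≫ homOfLE (face_le 𝔣.U β 1))
      (E.presheaf.map (k ≫ homOfLE (face_le 𝔣.U β 1)).op (basisSection (𝔣.e (β 1)) l)) j)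
      (E.presheaf.map (k ≫ homOfLE (face_le 𝔣.U β 1)).op (basisSection (𝔣.e (β 1)) j)) = 0 := by
    refine Finset.sum_eq_zero fun j _ => ?_
    rw [coord_map_basisSection]
    split_ifs
    · exact deltaHom_one E _
    · exact deltaHom_zero_left E _
  rw [hb, sub_zero]
  rfl

variable [HasExt.{u + 1} X.left.Modules]

/-- **The Atiyah class is the Čech class of the Atiyah cocycle of any framing**, for any exact
augmentation of the Čech complex of `E ⊗ Ω¹` by `Cech.augment` (e.g. the Čech resolution of the
cover `(U_a)`). [cite: Atiyah1957, §4] [cite: Hartshorne1977, III.4] -/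
theorem atiyahClass_eq_classOf (a : ExactAugmentation (Cech.complex 𝔣.U (twistCotangent E)) (twistCotangent E))
    (ha : a.ε = Cech.augment 𝔣.U (twistCotangent E)) :
    atiyahClass E = Cech.classOf a (atiyahCocycle 𝔣) (dFamily_atiyahCocycle 𝔣) :=
  (Cech.classOf_splittingDifference (frameJetSplittings 𝔣) (jetShortComplex_shortExact E) a ha).symm

/-- The same for the Čech resolution of a framing by a cover. [cite: Atiyah1957, §4] -/
theorem atiyahClass_eq_classOf_exactAugmentation (hU : iSup 𝔣.U = ⊤) :
    atiyahClass E = Cech.classOf (Cech.exactAugmentation 𝔣.U (twistCotangent E) hU) (atiyahCocycle 𝔣)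
      (dFamily_atiyahCocycle 𝔣) :=
  atiyahClass_eq_classOf 𝔣 _ (Cech.exactAugmentation_ε _ _ hU)

end Cocycle

end Literature.AlgebraicGeometry.HodgeTheory

end
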